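import Mathlib
import Literature.Probability.Percolation.SmoothedWhiteNoise
import Literature.Probability.Percolation.PercolationProofs
import Summits.CriticalPhenomena.CardyFormulaZ2.Theorems.CardyWhiteToColouredNoiseDiscretisationSignMeasurable
import Summits.CriticalPhenomena.CardyFormulaZ2.Theorems.CardyWhiteToColouredNoiseDiscretisationCrossing
import Summits.CriticalPhenomena.CardyFormulaZ2.Theorems.CardyWhiteToColouredNoiseDiscretisationTail
import Summits.CriticalPhenomena.CardyFormulaZ2.Theorems.CardyWhiteToColouredNoiseDiscretisationDiscrepancy

/-!
# Stub stub_whiteEnd — the white end of the noise heat flow (line `birth` of crux `DriftBound`)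

Helper file for crux item `DriftBound` (stmt-CriticalPhenomena-4596) of route `CardyWhiteToColoured`
(`CardyFormulaZ2`), stub A of the registered line `Cruxes/DriftBound/Lines/birth.lean`.

At a fixed mesh `δ > 0`, the crossing probability `P(s) = smoothedCrossingProb s δ R (arc 0) (arc 2)`
of a conformal rectangle `R` by the positive set of the lattice white noise `ξ` (i.i.d. `N(0,1)` on
the edges of `ℤ²`, placed at the medial points `m_δ(e)`) smoothed by the Gaussian kernel of width
`s` tends, as `s → 0⁺`, to the bond-`ℤ²` crossing probability `bondDomainCrossingProb R δ` at
`p = 1/2`: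

* the sign map `ξ ↦ {e ∈ E(ℤ²) | ξ_e > 0}` pushes the lattice white noise to
  `bondPercolation (zdGraph 2) half` (`P(ξ_e > 0) = P(ξ_e < 0) = 1/2` by the symmetry of `N(0,1)`
  and the absence of atoms; product structure by `Measure.infinitePi_map_pi`);
* for almost every `ξ` and every edge `e`, the smoothed field at `m_δ(e)`,
  `∑' e', exp(−|m_δ e − m_δ e'|²/(2s²)) ξ_{e'}`, tends to `ξ_e ≠ 0` as `s → 0⁺` (dominated
  convergence for series: distinct medial points are `≥ δ/2` apart, and the kernel sum at width
  `δ` against `|ξ|` is a.s. finite), so the sign of the field at `m_δ(e)` is eventually the sign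
  of `ξ_e`;
* the crossing event only depends on the finitely many inner edges of `R` at mesh `δ`, so the
  indicator of `{signConfig s δ ξ crosses}` converges a.s. to that of `{{ξ > 0} crosses}`, and the
  probabilities converge (dominated convergence for indicators).

References: S. Muirhead, H. Vanneuville, Ann. Inst. H. Poincaré Probab. Stat. 56 (2020), §2.1;
G. Grimmett, *Percolation* (1999), §1.3.
-/

noncomputable section

namespace Summit.CriticalPhenomena.CardyFormulaZ2.Cruxes.DriftBound.Birth

open Set Filter Topology MeasureTheory ProbabilityTheory
open scoped ENNReal NNReal
open Literature.Probability.LatticeModels Literature.Probability.Percolation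
open Literature.Probability.RandomPlanarGeometry
open Summit.CriticalPhenomena.CardyFormulaZ2.Theorems.WhiteToColoured

/-- `PosSign[ξ]`: the bond configuration `{e ∈ E(ℤ²) | ξ_e > 0}` of positive noise variables. -/
local notation3 "PosSign[" ξ "]" =>
  {e : Sym2 (Site 2) | ∃ h : e ∈ (zdGraph 2).edgeSet, (0 : ℝ) < (ξ : (zdGraph 2).edgeSet → ℝ) ⟨e, h⟩}

/-! ### The law of the signs: `{ξ > 0}` is bond percolation at `p = 1/2` -/

/-- `P(ξ > 0) = 1/2` for `ξ ∼ N(0, 1)`: the law is symmetric and has no atom at `0`. -/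
theorem gaussianReal_Ioi_zero : gaussianReal 0 1 (Ioi (0 : ℝ)) = ENNReal.ofReal (1 / 2) := by
  haveI := nullSingletonClass_gaussianReal (μ := (0 : ℝ)) (v := 1) one_ne_zero
  set γ : Measure ℝ := gaussianReal 0 1 with hγ
  have hneg : γ.map (fun x : ℝ => -x) = γ := by
    rw [hγ, gaussianReal_map_neg, neg_zero]
  have hIio : γ (Iio 0) = γ (Ioi 0) := by
    have h := Measure.map_apply (μ := γ) measurable_neg (measurableSet_Iio (a := (0 : ℝ)))
    rw [hneg] at h
    rw [h]
    congr 1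
    ext x
    simp
  have hIic : γ (Iic 0) = γ (Ioi 0) := by
    rw [← hIio]
    exact (measure_congr (Iio_ae_eq_Iic (μ := γ) (a := (0 : ℝ)))).symm
  have hcompl : γ (Ioi 0) = 1 - γ (Ioi 0) := by
    rw [← prob_compl_eq_one_sub measurableSet_Ioi, compl_Ioi, hIic]
  have hne : γ (Ioi 0) ≠ ⊤ := measure_ne_top _ _
  have hreal : γ.real (Ioi 0) = 1 / 2 := by
    have h2 : γ.real (Ioi 0) = 1 - γ.real (Ioi 0) := by
      rw [measureReal_def]
      conv_lhs => rw [hcompl]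
      rw [ENNReal.toReal_sub_of_le (prob_le_one) ENNReal.one_ne_top, ENNReal.toReal_one]
    linarith
  rw [← ofReal_measureReal hne, hreal]

/-- `P(ξ ≤ 0) = 1/2` for `ξ ∼ N(0, 1)`. -/
theorem gaussianReal_Iic_zero : gaussianReal 0 1 (Iic (0 : ℝ)) = ENNReal.ofReal (1 / 2) := by
  rw [← compl_Ioi, prob_compl_eq_one_sub measurableSet_Ioi, gaussianReal_Ioi_zero,
    ← ENNReal.ofReal_one, ← ENNReal.ofReal_sub _ (by norm_num : (0 : ℝ) ≤ 1 / 2)]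
  norm_num

/-- `toNNReal half = 1/2` as an extended non-negative real. -/
theorem coe_toNNReal_half : ((unitInterval.toNNReal half : ℝ≥0) : ℝ≥0∞) = ENNReal.ofReal (1 / 2) := by
  rw [ENNReal.ofReal_eq_coe_nnreal (by norm_num : (0 : ℝ) ≤ 1 / 2)]
  rfl

/-- `toNNReal (σ half) = 1/2` as an extended non-negative real. -/
theorem coe_toNNReal_symm_half :
    ((unitInterval.toNNReal (unitInterval.symm half) : ℝ≥0) : ℝ≥0∞) = ENNReal.ofReal (1 / 2) := by
  rw [ENNReal.ofReal_eq_coe_nnreal (by norm_num : (0 : ℝ) ≤ 1 / 2), ENNReal.coe_inj]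
  ext
  rw [unitInterval.coe_toNNReal, unitInterval.coe_symm_eq, coe_half]
  norm_num

/-- The one-edge threshold map `x ↦ [e ∈ E(ℤ²) ∧ 0 < x]` is measurable. -/
theorem measurable_posEdge (e : Sym2 (Site 2)) :
    Measurable fun x : ℝ => (e ∈ (zdGraph 2).edgeSet ∧ 0 < x) :=
  measurable_const.and (measurableSet_setOf.1 measurableSet_Ioi)

/-- **The law of one sign.** Under `N(0,1)` the indicator `[e ∈ E(ℤ²) ∧ 0 < x]` has law
`½ δ_{(e ∈ E(ℤ²))} + ½ δ_False` — the one-edge factor of `setBer(E(ℤ²), 1/2)`. -/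
theorem map_posEdge_gaussianReal (e : Sym2 (Site 2)) :
    (gaussianReal 0 1).map (fun x : ℝ => (e ∈ (zdGraph 2).edgeSet ∧ 0 < x)) =
      unitInterval.toNNReal half • Measure.dirac (e ∈ (zdGraph 2).edgeSet) +
        unitInterval.toNNReal (unitInterval.symm half) • Measure.dirac False := by
  refine Measure.ext_of_singleton fun a => ?_
  rw [Measure.map_apply (measurable_posEdge e) (measurableSet_singleton a)]
  simp only [Measure.coe_add, Measure.coe_smul, Pi.add_apply, Pi.smul_apply, ENNReal.smul_def,
    smul_eq_mul, coe_toNNReal_half, coe_toNNReal_symm_half]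
  by_cases he : e ∈ (zdGraph 2).edgeSet
  · have heT : (e ∈ (zdGraph 2).edgeSet) = True := eq_true he
    rcases Classical.em a with ha | ha
    · obtain rfl : a = True := eq_true ha
      have hpre : (fun x : ℝ => (e ∈ (zdGraph 2).edgeSet ∧ 0 < x)) ⁻¹' {True} = Ioi 0 := by
        ext x; simp [he]
      rw [hpre, gaussianReal_Ioi_zero, heT]
      simp
    · obtain rfl : a = False := eq_false ha
      have hpre : (fun x : ℝ => (e ∈ (zdGraph 2).edgeSet ∧ 0 < x)) ⁻¹' {False} = Iic 0 := by
        ext x; simp [he]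
      rw [hpre, gaussianReal_Iic_zero, heT]
      simp
  · have heF : (e ∈ (zdGraph 2).edgeSet) = False := eq_false he
    rcases Classical.em a with ha | ha
    · obtain rfl : a = True := eq_true ha
      have hpre : (fun x : ℝ => (e ∈ (zdGraph 2).edgeSet ∧ 0 < x)) ⁻¹' {True} = ∅ := by
        ext x; simp [he]
      rw [hpre, measure_empty, heF]
      simp
    · obtain rfl : a = False := eq_false ha
      have hpre : (fun x : ℝ => (e ∈ (zdGraph 2).edgeSet ∧ 0 < x)) ⁻¹' {False} = univ := by
        ext x; simp [he]
      rw [hpre, measure_univ, heF, Measure.dirac_apply_of_mem (mem_singleton _)]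
      simp only [mul_one]
      rw [← ENNReal.ofReal_add (by norm_num) (by norm_num), ← ENNReal.ofReal_one]
      norm_num

/-- The sign map `ξ ↦ {e ∈ E(ℤ²) | ξ_e > 0}` is a measurable map into bond configurations. -/
theorem measurable_posSign :
    Measurable fun ξ : (zdGraph 2).edgeSet → ℝ => PosSign[ξ] := by
  refine measurable_set_iff.2 fun e => ?_
  simp only [mem_setOf_eq]
  by_cases he : e ∈ (zdGraph 2).edgeSet
  · have : (fun ξ : (zdGraph 2).edgeSet → ℝ => ∃ h : e ∈ (zdGraph 2).edgeSet, (0 : ℝ) < ξ ⟨e, h⟩) =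
        fun ξ => (0 : ℝ) < ξ ⟨e, he⟩ := by
      funext ξ; simp [he]
    rw [this]
    exact measurableSet_setOf.1 (measurableSet_lt measurable_const (measurable_pi_apply _))
  · have : (fun ξ : (zdGraph 2).edgeSet → ℝ => ∃ h : e ∈ (zdGraph 2).edgeSet, (0 : ℝ) < ξ ⟨e, h⟩) =
        fun _ => False := by
      funext ξ; simp [he]
    rw [this]
    exact measurable_const

/-- The sign map factors through the restriction to the edges of a function on all of
`Sym2 (Site 2)`: `PosSign[U|_E] = {e | e ∈ E ∧ 0 < U e}`. -/
theorem posSign_comp_restrict :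
    ((fun ξ : (zdGraph 2).edgeSet → ℝ => PosSign[ξ]) ∘ Set.restrict (zdGraph 2).edgeSet) =
      (fun q : Sym2 (Site 2) → Prop => {e | q e}) ∘
        fun (U : Sym2 (Site 2) → ℝ) (e : Sym2 (Site 2)) => (e ∈ (zdGraph 2).edgeSet ∧ 0 < U e) := by
  funext U
  ext e
  simp [Set.restrict_apply, exists_prop]

/-- **The law of the signs is bond percolation at `p = 1/2`.** The push-forward of the lattice
white noise under `ξ ↦ {e ∈ E(ℤ²) | ξ_e > 0}` is `bondPercolation (zdGraph 2) half`: realise the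
`E(ℤ²)`-indexed product as the restriction of the `Sym2`-indexed product of `N(0,1)`
(`Measure.infinitePi_map_restrict'`), push forward coordinatewise (`Measure.infinitePi_map_pi`)
and identify each factor (`map_posEdge_gaussianReal`) with the factor of `setBer(E(ℤ²), 1/2)`
(`setBernoulli_eq_map`). -/
theorem map_posSign_latticeWhiteNoise :
    latticeWhiteNoise.map (fun ξ : (zdGraph 2).edgeSet → ℝ => PosSign[ξ]) =
      bondPercolation (zdGraph 2) half := by
  have h1 : (Measure.infinitePi (fun _ : Sym2 (Site 2) => gaussianReal 0 1)).map
      (Set.restrict (zdGraph 2).edgeSet) = latticeWhiteNoise :=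
    Measure.infinitePi_map_restrict' _
  rw [← h1, Measure.map_map measurable_posSign (Set.measurable_restrict _), posSign_comp_restrict,
    ← Measure.map_map (g := fun q : Sym2 (Site 2) → Prop => {e | q e})
      (f := fun (U : Sym2 (Site 2) → ℝ) (e : Sym2 (Site 2)) => (e ∈ (zdGraph 2).edgeSet ∧ 0 < U e))
      measurable_setOf (measurable_pi_lambda _ fun e =>
        (measurable_posEdge e).comp (measurable_pi_apply e)),
    Measure.infinitePi_map_pi _ (fun e => measurable_posEdge e), bondPercolation,
    setBernoulli_eq_map]
  congrm Measure.map _ (Measure.infinitePi fun e => ?_)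
  exact map_posEdge_gaussianReal e

/-- The probability that the signs realise a measurable event of bond configurations is its
`P_{1/2}`-probability. -/
theorem latticeWhiteNoise_posSign_preimage {Ev : Set (BondConfig (Site 2))} (hEv : MeasurableSet Ev) :
    latticeWhiteNoise ((fun ξ : (zdGraph 2).edgeSet → ℝ => PosSign[ξ]) ⁻¹' Ev) =
      bondPercolation (zdGraph 2) half Ev := by
  rw [← Measure.map_apply measurable_posSign hEv, map_posSign_latticeWhiteNoise]

/-! ### The smoothed field at a medial point tends to the noise variable there -/

/-- Distinct edges of `ℤ²` have medial points at Euclidean distance at least `δ/2`, in particular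
at positive distance. -/
theorem norm_medialPoint_sub_pos {δ : ℝ} (hδ : 0 < δ) {e e' : Sym2 (Site 2)}
    (he : e ∈ (zdGraph 2).edgeSet) (he' : e' ∈ (zdGraph 2).edgeSet) (hne : e ≠ e') :
    0 < ‖medialPoint δ e - medialPoint δ e'‖ := by
  have h1 := le_dg_medialPoint_sub hδ he he' hne
  have h2 := dg_le_two_mul_norm (medialPoint δ e - medialPoint δ e')
  linarith

/-- The Gaussian weight `exp(−d²/(2s²))` of a non-zero displacement tends to `0` with the width
`s → 0⁺`. -/
theorem tendsto_exp_neg_sq_div {d : ℝ} (hd : 0 < d) :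
    Tendsto (fun s : ℝ => Real.exp (-(d ^ 2) / (2 * s ^ 2))) (𝓝[>] 0) (𝓝 0) := by
  have h1 : Tendsto (fun s : ℝ => (s⁻¹) ^ 2) (𝓝[>] 0) atTop :=
    (tendsto_pow_atTop two_ne_zero).comp tendsto_inv_nhdsGT_zero
  have h2 : Tendsto (fun s : ℝ => (-(d ^ 2) / 2) * (s⁻¹) ^ 2) (𝓝[>] 0) atBot :=
    h1.const_mul_atTop_of_neg (by have := pow_pos hd 2; linarith)
  refine (Real.tendsto_exp_atBot.comp h2).congr fun s => ?_
  simp only [Function.comp_apply]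
  congr 1
  rw [inv_pow]
  ring

/-- **The smoothed field at `m_δ(e)` tends to `ξ_e` as the width `s → 0⁺`**, whenever the kernel
sum at width `δ` converges absolutely against `ξ` (dominated convergence for series: the weight
of `e' ≠ e` tends to `0`, the weight of `e` is `1`, and for `s ≤ δ` the weights are dominated by
those at width `δ`). -/
theorem tendsto_smoothedNoise_medialPoint {δ : ℝ} (hδ : 0 < δ) (e : (zdGraph 2).edgeSet)
    {ξ : (zdGraph 2).edgeSet → ℝ}
    (hξ : Summable fun e' : (zdGraph 2).edgeSet =>
      gaussWeight δ (medialPoint δ e.1 - medialPoint δ e'.1) * |ξ e'|) :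
    Tendsto (fun s => smoothedNoise s δ ξ (medialPoint δ e.1)) (𝓝[>] 0) (𝓝 (ξ e)) := by
  classical
  have hlim : ∑' e' : (zdGraph 2).edgeSet, (if e' = e then ξ e' else 0) = ξ e := tsum_ite_eq e _
  rw [← hlim]
  unfold smoothedNoise
  refine tendsto_tsum_of_dominated_convergence hξ (fun e' => ?_) ?_
  · by_cases h : e' = e
    · subst h
      simp only [if_true, sub_self, norm_zero, ne_eq, OfNat.ofNat_ne_zero, not_false_eq_true,
        zero_pow, neg_zero, zero_div, Real.exp_zero, one_mul]
      exact tendsto_const_nhds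
    · rw [if_neg h]
      have hne : (e.1 : Sym2 (Site 2)) ≠ e'.1 := fun h' => h (Subtype.ext h').symm
      have hd := norm_medialPoint_sub_pos hδ e.2 e'.2 hne
      simpa using (tendsto_exp_neg_sq_div hd).mul_const (ξ e')
  · filter_upwards [Ioc_mem_nhdsGT hδ] with s hs
    have hs0 : 0 < s := hs.1
    have hsδ : s ≤ δ := hs.2
    intro e'
    rw [Real.norm_eq_abs, abs_mul, abs_of_pos (Real.exp_pos _)]
    refine mul_le_mul_of_nonneg_right ?_ (abs_nonneg _)
    unfold gaussWeight
    refine Real.exp_le_exp.2 ?_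
    rw [neg_div, neg_div, neg_le_neg_iff]
    exact div_le_div_of_nonneg_left (sq_nonneg _) (by positivity) (by nlinarith)

/-- Once the field at `m_δ(e)` tends to `ξ_e ≠ 0`, its sign is eventually the sign of `ξ_e`. -/
theorem eventually_pos_iff_of_tendsto {F : ℝ → ℝ} {a : ℝ} {l : Filter ℝ} (h : Tendsto F l (𝓝 a))
    (ha : a ≠ 0) : ∀ᶠ s in l, (0 < F s ↔ 0 < a) := by
  rcases lt_or_gt_of_ne ha with hlt | hgt
  · filter_upwards [h.eventually (Iio_mem_nhds hlt)] with s hs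
    exact iff_of_false (not_lt.2 (le_of_lt hs)) (not_lt.2 hlt.le)
  · filter_upwards [h.eventually (Ioi_mem_nhds hgt)] with s hs
    exact iff_of_true hs hgt

/-! ### Almost sure properties of the lattice white noise -/

/-- **Almost surely, the kernel sum at width `δ` converges absolutely against the noise**:
`∑' e', q_δ(x − m_δ e') |ξ_{e'}| < ∞` a.s. (its expectation is `E|N(0,1)| · ∑' e', q_δ(x − m_δ e')`,
finite by `summable_gaussWeight_medial`). -/
theorem ae_summable_gaussWeight_mul_abs {δ : ℝ} (hδ : 0 < δ) (x : ℂ) :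
    ∀ᵐ ξ ∂latticeWhiteNoise, Summable fun e' : (zdGraph 2).edgeSet =>
      gaussWeight δ (x - medialPoint δ e'.1) * |ξ e'| := by
  set Y : ((zdGraph 2).edgeSet → ℝ) → ℝ≥0∞ := fun ξ =>
    ∑' e' : (zdGraph 2).edgeSet, ‖gaussWeight δ (x - medialPoint δ e'.1) * ξ e'‖ₑ with hY
  have hmeas : ∀ e' : (zdGraph 2).edgeSet, Measurable fun ξ : (zdGraph 2).edgeSet → ℝ =>
      ‖gaussWeight δ (x - medialPoint δ e'.1) * ξ e'‖ₑ := fun e' =>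
    (measurable_const.mul (measurable_pi_apply e')).enorm
  have hYm : Measurable Y := Measurable.tsum hmeas
  have hYint : ∫⁻ ξ, Y ξ ∂latticeWhiteNoise ≠ ⊤ := by
    rw [hY, lintegral_tsum fun e' => (hmeas e').aemeasurable]
    have hle : ∀ e' : (zdGraph 2).edgeSet,
        ∫⁻ ξ, ‖gaussWeight δ (x - medialPoint δ e'.1) * ξ e'‖ₑ ∂latticeWhiteNoise =
          ENNReal.ofReal (gaussWeight δ (x - medialPoint δ e'.1)) * ∫⁻ ξ, ‖ξ e'‖ₑ ∂latticeWhiteNoise := by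
      intro e'
      have : (fun ξ : (zdGraph 2).edgeSet → ℝ => ‖gaussWeight δ (x - medialPoint δ e'.1) * ξ e'‖ₑ) =
          fun ξ => ENNReal.ofReal (gaussWeight δ (x - medialPoint δ e'.1)) * ‖ξ e'‖ₑ := by
        funext ξ
        rw [enorm_mul, Real.enorm_eq_ofReal (gaussWeight_pos δ _).le]
      rw [this, lintegral_const_mul _ (measurable_pi_apply e').enorm]
    have hC : ∀ e' : (zdGraph 2).edgeSet,
        ∫⁻ ξ, ‖ξ e'‖ₑ ∂latticeWhiteNoise = ∫⁻ t : ℝ, ‖t‖ₑ ∂(gaussianReal 0 1) := fun e' =>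
      (measurePreserving_eval_infinitePi (fun _ : (zdGraph 2).edgeSet => gaussianReal 0 1)
        e').lintegral_comp measurable_enorm
    have hCfin : ∫⁻ t : ℝ, ‖t‖ₑ ∂(gaussianReal 0 1) ≠ ⊤ := by
      have hint : Integrable (id : ℝ → ℝ) (gaussianReal 0 1) :=
        memLp_one_iff_integrable.1 (memLp_id_gaussianReal' 1 ENNReal.one_ne_top)
      have hfin := hint.hasFiniteIntegral
      rw [HasFiniteIntegral] at hfin
      exact hfin.ne
    simp_rw [hle, hC]
    rw [ENNReal.tsum_mul_right]
    exact ENNReal.mul_ne_top (tsum_ofReal_gaussWeight_medial_ne_top hδ hδ le_rfl x) hCfin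
  filter_upwards [ae_lt_top hYm hYint] with ξ hξ
  have h1 : (∑' e' : (zdGraph 2).edgeSet,
      ((‖gaussWeight δ (x - medialPoint δ e'.1) * ξ e'‖₊ : ℝ≥0) : ℝ≥0∞)) ≠ ⊤ := hξ.ne
  have h2 := NNReal.summable_coe.2 (ENNReal.tsum_coe_ne_top_iff_summable.1 h1)
  refine h2.congr fun e' => ?_
  simp only [coe_nnnorm, norm_mul, Real.norm_eq_abs, abs_of_pos (gaussWeight_pos δ _)]

/-- **Almost surely no noise variable vanishes** (`N(0,1)` has no atoms). -/
theorem ae_eval_ne_zero (e : (zdGraph 2).edgeSet) : ∀ᵐ ξ ∂latticeWhiteNoise, ξ e ≠ 0 := by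
  haveI := nullSingletonClass_gaussianReal (μ := (0 : ℝ)) (v := 1) one_ne_zero
  have h : ∀ᵐ t ∂(latticeWhiteNoise.map fun ξ : (zdGraph 2).edgeSet → ℝ => ξ e), t ≠ (0 : ℝ) := by
    rw [show latticeWhiteNoise.map (fun ξ : (zdGraph 2).edgeSet → ℝ => ξ e) = gaussianReal 0 1 from
      Measure.infinitePi_map_eval _ e]
    exact Measure.ae_ne _ 0
  exact (ae_map_iff (measurable_pi_apply e).aemeasurable (measurableSet_singleton (0 : ℝ)).compl).1 h

/-- **The good set of noises has full measure**: almost surely, for every edge `e`, the smoothed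
field at `m_δ(e)` tends to `ξ_e` as `s → 0⁺` and `ξ_e ≠ 0`. -/
theorem ae_tendsto_smoothedNoise_and_ne_zero {δ : ℝ} (hδ : 0 < δ) :
    ∀ᵐ ξ ∂latticeWhiteNoise, ∀ e : (zdGraph 2).edgeSet,
      Tendsto (fun s => smoothedNoise s δ ξ (medialPoint δ e.1)) (𝓝[>] 0) (𝓝 (ξ e)) ∧ ξ e ≠ 0 := by
  rw [ae_all_iff]
  intro e
  filter_upwards [ae_summable_gaussWeight_mul_abs hδ (medialPoint δ e.1), ae_eval_ne_zero e]
    with ξ h1 h2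
  exact ⟨tendsto_smoothedNoise_medialPoint hδ e h1, h2⟩

/-! ### Assembly -/

/-- On finitely many edges, the sign configuration of the smoothed field eventually agrees with
the signs of the noise (each edge is eventually correct, `eventually_pos_iff_of_tendsto`). -/
theorem eventually_signConfig_iff_posSign {δ : ℝ} (I : Finset (Sym2 (Site 2)))
    {ξ : (zdGraph 2).edgeSet → ℝ}
    (hξ : ∀ e : (zdGraph 2).edgeSet,
      Tendsto (fun s => smoothedNoise s δ ξ (medialPoint δ e.1)) (𝓝[>] 0) (𝓝 (ξ e)) ∧ ξ e ≠ 0) :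
    ∀ᶠ s in 𝓝[>] (0 : ℝ), ∀ e ∈ I, (e ∈ signConfig s δ ξ ↔ e ∈ PosSign[ξ]) := by
  refine (Filter.eventually_all_finset I).2 fun e _ => ?_
  by_cases he : e ∈ (zdGraph 2).edgeSet
  · filter_upwards [eventually_pos_iff_of_tendsto (hξ ⟨e, he⟩).1 (hξ ⟨e, he⟩).2] with s hs
    have hs' : 0 < smoothedNoise s δ ξ (medialPoint δ e) ↔ 0 < ξ ⟨e, he⟩ := hs
    rw [mem_signConfig_iff, hs']
    simp [he]
  · exact Eventually.of_forall fun s => by simp [mem_signConfig_iff, he]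

/-- **Stub A — the white end of the flow.** At fixed mesh `δ > 0` the crossing probability of the
smoothed lattice model tends, as the smoothing scale `s → 0⁺`, to the bond-`ℤ²` crossing
probability at `p = 1/2`: almost surely the sign configuration eventually agrees with `{ξ > 0}` on
the finitely many inner edges of `R` at mesh `δ` (`ae_tendsto_smoothedNoise_and_ne_zero`,
`exists_finset_innerE_subset`), the crossing event only depends on those edges
(`mem_discreteCrossing_iff_of_inter_innerE_eq`), so the probabilities converge (dominated
convergence for indicators, `tendsto_measure_of_ae_tendsto_indicator_of_isFiniteMeasure`), and the
law of `{ξ > 0}` is `bondPercolation (zdGraph 2) half` (`map_posSign_latticeWhiteNoise`,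
`bondDomainCrossingProb_eq_measureReal`). -/
theorem stub_whiteEnd :
    ∀ R : Literature.Probability.RandomPlanarGeometry.ConformalRectangle, ∀ δ : ℝ, 0 < δ →
      Filter.Tendsto (fun s : ℝ => Literature.Probability.Percolation.smoothedCrossingProb s δ R.carrier (R.arc 0) (R.arc 2))
        (nhdsWithin (0 : ℝ) (Set.Ioi 0)) (nhds (Literature.Probability.Percolation.bondDomainCrossingProb R δ)) := by
  intro R δ hδ
  set Ev : Set (BondConfig (Site 2)) := discreteCrossing R.carrier δ (R.arc 0) (R.arc 2)
  have hEv : MeasurableSet Ev := measurableSet_discreteCrossing _ _ _ _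
  -- finitely many inner edges
  obtain ⟨ρ, hΩρ⟩ := (Metric.isBounded_iff_subset_closedBall (0 : ℂ)).1 R.isBounded
  have hΩ : R.carrier ⊆ Metric.closedBall (0 : ℂ) (max ρ 0) :=
    hΩρ.trans (Metric.closedBall_subset_closedBall (le_max_left _ _))
  obtain ⟨I, hI, -⟩ := exists_finset_innerE_subset (le_max_right _ _) hΩ hδ
  -- convergence of the probabilities of the pulled-back crossing events
  have key : Tendsto (fun s => latticeWhiteNoise (signConfig s δ ⁻¹' Ev)) (𝓝[>] 0)
      (𝓝 (latticeWhiteNoise ((fun ξ : (zdGraph 2).edgeSet → ℝ => PosSign[ξ]) ⁻¹' Ev))) := by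
    refine tendsto_measure_of_ae_tendsto_indicator_of_isFiniteMeasure (𝓝[>] (0 : ℝ))
      (hEv.preimage measurable_posSign)
      (fun s => measurableSet_signConfig_preimage_discreteCrossing s δ _ _ _) ?_
    filter_upwards [ae_tendsto_smoothedNoise_and_ne_zero hδ] with ξ hξ
    filter_upwards [eventually_signConfig_iff_posSign I hξ] with s hs
    simp only [mem_preimage]
    refine mem_discreteCrossing_iff_of_inter_innerE_eq ?_
    ext e
    simp only [mem_inter_iff]
    constructor
    · rintro ⟨h1, h2⟩
      exact ⟨(hs e (hI h2)).1 h1, h2⟩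
    · rintro ⟨h1, h2⟩
      exact ⟨(hs e (hI h2)).2 h1, h2⟩
  rw [latticeWhiteNoise_posSign_preimage hEv] at key
  have key' := (ENNReal.tendsto_toReal (measure_ne_top _ _)).comp key
  show Tendsto (fun s => (latticeWhiteNoise (signConfig s δ ⁻¹' Ev)).toReal) (𝓝[>] 0)
    (𝓝 (bondDomainCrossingProb R δ))
  rw [bondDomainCrossingProb_eq_measureReal, measureReal_def]
  exact key'

end Summit.CriticalPhenomena.CardyFormulaZ2.Cruxes.DriftBound.Birth
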